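import Summits.HodgeConjecture.HodgeConjecture.Theorems.PadicSemiregularLiftHodgeFermatVarietiesPQTwinClassification

/-!
# Level `pq` WITHOUT `p + 2 < q`, V — reachability, the HC pay-off `hodgeConjectureFor_pqT`, the twin corollaries and ALL two-odd-prime levels at once

Part 5 of 5 (Sketch step 2 §1–§3 + §T, ll. 844–1062). With the line's local notation (`Supply[M]`, `Reach[M, s]`, `LevelRaise`, `StableReach`, `LevelClaimPull`,
`LevelClaimPush`, `SemiClaim`, `EigenStructure` — verbatim from `Theorems/PadicSemiregularLiftHodgeFermatVarietiesPQPayoff`): `std_mem_supply_pqT`, `reachPQT`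
(S15: every Hodge `(p+1)`-tuple of level `pq` is reachable at its own level), **`hodgeConjectureFor_pqT`** (HC for the Fermat `(p−1)`-folds of degree `pq`,
`5 ≤ p < q`, `11 ≤ q`, modulo the named facts S0 and the stub statements S2↑, S2↓, S3a, S5 — exactly the hypotheses of the tree's `PQ.hodgeConjectureFor_pq`);
the twin corollaries `pqClassification_twin`, `hodgeConjectureFor_twin` (`q = p + 2`, `p ≥ 11`), the numeric instance `pqClassification_143`; and
**`pqClassification_all` ∕ `hodgeConjectureFor_pq_all`**: ALL pairs of primes `5 ≤ p < q` at once (`q ≥ 11` here, `(p, q) = (5, 7)` from the tree's `FiveQ` files).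

PROVENANCE. Cell hodge-nonav (HUMAN RULING D-0038), planner seat p1 g33: chapter ROUTE-P1AF addenda ADD2 ∕ ADD3 (memos `HOME/memos/ROUTE-P1AF-ADD2.md`
d3af0b1bf97b24f6, `…-ADD3.md` 5042c485c3dfa6c1; referee PASS 0∕0: ref g51 REF-P1AF-ADD2.md, REF-P1AF-ADD3.md 5111ed97ffe1fe84), frozen Sketch
`HOME/p1/route/Sketch_P1AF_TWIN_ALL_g33.lean` (sha16 48c9088b216d60cb, 1063 lines, namespace `HodgeNonAV.P1AF.Twin`, farm rc 0 / 0 sorries / axioms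
{propext, Classical.choice, Quot.sound}; re-elaborated 2026-08-28), split into five tree modules `…PQTwinCounting` → `…PQTwinStructure` → `…PQTwinFibre` →
`…PQTwinClassification` → `…PQTwinPayoff` by planner p1 g34 (landing kit HOME/p1/landing/); proof bodies verbatim; docstrings reworded per referee riders
N-ADD2-1 ∕ N-ADD3-1 (hypotheses read `5 ≤ p`, `p < q`, `11 ≤ q` as the theorems carry them; no cell tags; Aoki cites are METHOD attributions — the
statements at the twin levels are not in print). A parallel `T`-family rather than a weakening of the tree's `PQFibre ∕ PQClassification ∕ PQPayoff`
hypothesis `p + 2 < q`, because Theorems files are append-only; an operator refactor may later merge the two spellings.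
Extends line `cancel-by-any-claim-lattice` of crux `HodgeFermatVarieties` (route `PadicSemiregularLift`): land with `--supports stmt-HodgeConjecture-1334`
(or `--supports stmt-HodgeConjecture-19652 --as helper`). No instance, no new notation (Part 5's eight `local notation3` are the line's, verbatim from
`Theorems/PadicSemiregularLiftHodgeFermatVarietiesPQPayoff`), no sorry, no new axiom.
HONEST SCOPE: combinatorics of Hodge `(p+1)`-multisets of `ℤ/pq` and the HC pay-off for the Fermat `(p−1)`-folds `X^{p−1}_{pq}` MODULO the line's named
facts (S0) and stub statements (S2↑, S2↓, S3a, S5) — exactly the hypotheses of the tree's `PQ.hodgeConjectureFor_pq`; Fermat varieties are dominated by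
abelian motives, so this is inside the known (AV) region of the summit; NOTHING here proves the Hodge conjecture.
References (method): N. Aoki, Math. Ann. 266 (1983) Thm A′ (§7), Prop. 2.2 [cite: Aoki1983, Thm. A]; N. Aoki, J. Math. Soc. Japan 39 (1987) §1, Thm 2-1
[cite: Aoki1987, Thm. 2-1]; T. Shioda, Math. Ann. 245 (1979) [cite: Shioda1979PJA, Thm. I].
-/

set_option linter.dupNamespace false
set_option linter.unusedVariables false

noncomputable section

namespace Summit.HodgeConjecture.HodgeConjecture.Theorems.CancelByAnyClaimLattice.PQTwin

open Finset
open CategoryTheory AlgebraicGeometry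
open Literature.AlgebraicGeometry Literature.AlgebraicGeometry.Motives Literature.AlgebraicTopology.SingularHomology
open Literature.AlgebraicGeometry.HodgeTheory Literature.AlgebraicGeometry.HodgeTheory.FermatCharacter
open Summit.HodgeConjecture.HodgeConjecture.Theorems.CancelByAnyClaimLattice.FiveQ
open Summit.HodgeConjecture.HodgeConjecture.Theorems.CancelByAnyClaimLattice.PQ
open Summit.HodgeConjecture.HodgeConjecture.Theorems.CancelByAnyClaimLattice



/-- `Supply[M]` — the printed supply of level `M` (local notation of the line, verbatim). -/
local notation3 (prettyPrint := false) "Supply[" M "]" =>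
  ({s : Multiset (ZMod M) | ∃ a : ZMod M, a ≠ 0 ∧ s = ({a, -a} : Multiset (ZMod M))} ∪
    {s : Multiset (ZMod M) | IsHodgeMultiset s ∧ Multiset.card s = 4} ∪
    {s : Multiset (ZMod M) | IsHodgeMultiset s ∧ IsSemiDecomposable s} ∪
    {s : Multiset (ZMod M) | ∃ (p : ℕ) (a : ZMod M), p.Prime ∧ p ≠ 2 ∧ p ∣ M ∧
        2 < (M / p) / Nat.gcd (ZMod.val a) (M / p) ∧
        s = Multiset.map (fun j : ℕ => a + (j : ZMod M) * ((M / p : ℕ) : ZMod M)) (Multiset.range p) +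
              {-((p : ZMod M) * a)}} : Set (Multiset (ZMod M)))

/-- `Reach[M, s]` (local notation of the line, verbatim). -/
local notation3 (prettyPrint := false) "Reach[" M ", " s "]" =>
  ∃ P N : Multiset (Multiset (ZMod M)),
    (∀ u ∈ P, u ∈ Supply[M]) ∧ (∀ u ∈ N, u ∈ Supply[M]) ∧ s + Multiset.sum N = Multiset.sum P

/-- `LevelRaise[k, m, s]` (local notation of the line, verbatim). -/
local notation3 (prettyPrint := false) "LevelRaise[" k ", " m ", " s "]" =>
  Multiset.map (fun a : ZMod m => ((k * ZMod.val a : ℕ) : ZMod (k * m))) s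

/-- `StableReach[m, s]` (local notation of the line, verbatim). -/
local notation3 (prettyPrint := false) "StableReach[" m ", " s "]" => ∃ k : ℕ, 0 < k ∧ Reach[k * m, LevelRaise[k, m, s]]

/-- The statement of stub S2↑ (pull-back of claim along level raising). Local notation only (verbatim
from `…DoublingHodge`). -/
local notation3 (prettyPrint := false) "LevelClaimPull" =>
  ∀ (m k r : ℕ) (α' : Fin (2 * r + 2) → ZMod m), 0 < k → (∀ i, α' i ≠ 0) →
    FermatCharacter.Claim m r α' → FermatCharacter.Claim (k * m) r (fun i => ((k * (α' i).val : ℕ) : ZMod (k * m)))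

/-- The statement of stub S2↓ (push-forward of claim along level raising). Local notation only. -/
local notation3 (prettyPrint := false) "LevelClaimPush" =>
  ∀ (m k r : ℕ) (α' : Fin (2 * r + 2) → ZMod m), 0 < k → (∀ i, α' i ≠ 0) →
    FermatCharacter.Claim (k * m) r (fun i => ((k * (α' i).val : ℕ) : ZMod (k * m))) → FermatCharacter.Claim m r α'

/-- The statement of stub S3a (Shioda's semi-decomposable supply is claimed). Local notation only. -/
local notation3 (prettyPrint := false) "SemiClaim" =>
  ∀ (M : ℕ) [NeZero M] (s : Multiset (ZMod M)), IsHodgeMultiset s → IsSemiDecomposable s → ClaimMultiset M s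

/-- The statement of stub S5 (eigenspace structure of `H²ᵖ(X²ᵖₘ)`, Ran Prop. 1.7) at every level.
Local notation only. -/
local notation3 (prettyPrint := false) "EigenStructure" =>
  ∀ (m : ℕ) [NeZero m] ⦃p : ℕ⦄, 0 < p →
    (∀ α : Fin (2 * p + 2) → ZMod m, α ≠ 0 → (∃ i, α i = 0) → fermatEigenspace m α (2 * p) = ⊥) ∧
    (fermatEigenspace m (0 : Fin (2 * p + 2) → ZMod m) (2 * p) ≤
      LinearMap.range (complexBetti.map (SmoothHypersurface.hypersurfaceι (fermatPolynomial ℂ (2 * p) m)) (2 * p)).hom) ∧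
    (∀ (A : HodgeModel (2 * p) (fermatHypersurface (2 * p) m)) (β : Fin (2 * p + 2) → ZMod m),
      (∀ i, β i ≠ 0) →
      (∃ x ∈ fermatEigenspace m β (2 * p), x ≠ 0 ∧ A.pullback (2 * p) x ∈ A.hodgePQ (2 * p) p p) →
        2 * FermatCharacter.normSum β = m * (2 * p + 2))

/-! ### §1 The standard element of a unit is in the printed supply -/

/-- **`σ_{p,a}` of a unit `a` of `ℤ/pq` lies in the printed supply of level `pq`**: the fourth component
with the prime `p` itself (`p ∣ pq`, `p ≠ 2`), `d = pq/p = q` and `(⟨a⟩, q) = 1` (`a` is a unit mod `pq`),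
so Aoki's side condition `d/(⟨a⟩, d) > 2` reads `q > 2`. [cite: Aoki1987, §1 p. 387 and Thm. 2-1 (p. 388)] -/
theorem std_mem_supply_pqT {p q : ℕ} [Fact p.Prime] (hp : 5 ≤ p) (hpq1 : p < q) (hq : 11 ≤ q) {a : ZMod (p * q)}
    (ha : IsUnit a) :
    (Multiset.range p).map (fun i : ℕ ↦ a + (i : ZMod (p * q)) * ((p * q / p : ℕ) : ZMod (p * q))) +
        {-((p : ZMod (p * q)) * a)} ∈ Supply[p * q] := by
  refine Or.inr ⟨p, a, Fact.out, by omega, dvd_mul_right p q, ?_, rfl⟩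
  have hp0 : 0 < p := by omega
  rw [Nat.mul_div_cancel_left q hp0]
  have hcop : Nat.gcd a.val q = 1 := by
    have h := ZMod.val_coe_unit_coprime ha.unit
    rw [ha.unit_spec] at h
    exact Nat.Coprime.coprime_dvd_right (dvd_mul_left q p) h
  rw [hcop, Nat.div_one]
  omega

/-! ### §2 S15: reachability at the own level -/

/-- **S15 — EVERY HODGE `(p+1)`-TUPLE OF LEVEL `pq` IS REACHABLE AT ITS OWN LEVEL** (primes `5 ≤ p < q`,
`11 ≤ q`): by the classification S14 it is a sum of pairs (`P :=` the pairs `{a, -a}`, `N := 0`) or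
Aoki's standard element `σ_{p,a}` of a unit (`P := {s}`, `N := 0`, `std_mem_supply_pqT`).
(method after [cite: Aoki1983, Thm. A′ (§7)] [cite: Aoki1987, Thm. 2-1 (p. 388)]) -/
theorem reachPQT :
    ∀ (p q : ℕ) [Fact p.Prime] [Fact q.Prime], 5 ≤ p → p < q → 11 ≤ q →
      ∀ s : Multiset (ZMod (p * q)), IsHodgeMultiset s → Multiset.card s = p + 1 → Reach[p * q, s] := by
  intro p q _ _ hp hpq1 hq s hs hcard
  rcases pqClassificationT p q hp hpq1 hq s hs hcard with ⟨Q, hQ0, hsQ⟩ | ⟨a, ha, hsa⟩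
  · -- pairs: `P :=` the pairs `{a, -a}`, `N := 0`
    refine ⟨Q.map fun a ↦ ({a, -a} : Multiset (ZMod (p * q))), 0, fun u hu ↦ ?_,
      fun u hu ↦ absurd hu (Multiset.notMem_zero u), ?_⟩
    · obtain ⟨a, haQ, rfl⟩ := Multiset.mem_map.1 hu
      exact ReachPrimePow.pair_mem_supply (hQ0 a haQ)
    · rw [Multiset.sum_zero, add_zero, ReachOfLargePrimes.sum_map_pair]
      exact hsQ
  · -- the standard element: `P := {s}`, `N := 0`
    refine ⟨{s}, 0, fun u hu ↦ ?_, fun u hu ↦ absurd hu (Multiset.notMem_zero u), ?_⟩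
    · rw [Multiset.mem_singleton] at hu
      rw [hu, hsa]
      exact std_mem_supply_pqT hp hpq1 hq ha
    · rw [Multiset.sum_zero, add_zero, Multiset.sum_singleton]

/-! ### §3 The Hodge-conjecture pay-off: the Fermat `(p-1)`-folds of degree `pq` -/

/-- **HC FOR THE FERMAT `(p−1)`-FOLDS OF DEGREE `pq`** (primes `5 ≤ p < q`, `11 ≤ q`; e.g. `X⁴₅₅`, `X⁶₇₇`,
`X⁶₉₁`, `X¹⁰_{11·17}`), granted the named facts of S0 and the statements of S2↑, S2↓, S3a and S5 at
`(pq, (p−1)/2)`: every Hodge character of `X^{p−1}_{pq}` has `p + 1` entries, so its value multiset is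
reachable at level `pq` (S15 `stub_reachPQ`), hence claimed (`Doubling.claimMultiset_of_stableReach`), and
the per-dimension transfer `hodgeConjectureFor_of_claims_dim` applies. The first dimension in which Aoki's
Thm A (`𝔅 = 𝔇` iff all primes of `m` exceed `n + 1`) does not cover the degree `pq`.
(method after [cite: Aoki1983, Thm. A′ (§7)] [cite: Aoki1987, Thm. 2-1 (p. 388)]) -/
theorem hodgeConjectureFor_pqT
    (hJ : Aoki1987_claim_juxtaposition) (hC : Aoki1987_claim_of_claim_juxtaposition_paired)
    (hP : Shioda_claim_paired) (hNS : AokiShioda1983_eigenline_le_neronSeveri) (hS : Aoki1987_claim_pStandard)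
    (hPull : LevelClaimPull) (hPush : LevelClaimPush) (h3a : SemiClaim) (h5 : EigenStructure)
    {p q : ℕ} [Fact p.Prime] [Fact q.Prime] (hp : 5 ≤ p) (hpq : p < q) (hq' : 11 ≤ q)
    ⦃X : SchemeOver ℂ⦄ (hF : IsFermatVariety (p - 1) (p * q) X) (hX : IsSmoothProjective (p - 1) X) :
    HodgeConjectureFor (p - 1) X := by
  haveI : NeZero (p * q) := ⟨Nat.mul_ne_zero (Fact.out : p.Prime).ne_zero (Fact.out : q.Prime).ne_zero⟩
  obtain ⟨r, hr⟩ : ∃ r, p = 2 * r + 1 := (Fact.out : p.Prime).odd_of_ne_two (by omega)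
  have hp1 : p - 1 = 2 * r := by omega
  rw [hp1] at hF hX ⊢
  have hr0 : 0 < r := by omega
  refine hodgeConjectureFor_of_claims_dim (m := p * q) (p := r) hr0 (h5 (p * q) hr0).1 (h5 (p * q) hr0).2.1
    (h5 (p * q) hr0).2.2 (fun α hα ↦ ?_) hF hX
  have hs : IsHodgeMultiset (univ.val.map α) := hα.isHodgeMultiset
  have hcard : Multiset.card (univ.val.map α) = p + 1 := by rw [card_univ_val_map]; omega
  have hs0 : univ.val.map α ≠ 0 := fun h0 ↦ by
    have h := congrArg Multiset.card h0
    rw [hcard, Multiset.card_zero] at h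
    omega
  have hR : Reach[p * q, univ.val.map α] := reachPQT p q hp hpq hq' _ hs hcard
  exact (claimMultiset_univ_val_map_iff α).1
    (Doubling.claimMultiset_of_stableReach hJ hC hP hNS hS hPull hPush h3a hs0 hs (Doubling.stableReach_of_reach hR))

/-! ### §T Twin corollaries (R-2P-twin of ROUTE-P1AF: the case `q = p + 2` the tree's `p + 2 < q` excludes) -/

/-- **CLASSIFICATION AT THE TWIN LEVELS `p(p+2)`, `p ≥ 11`**: every Hodge `(p+1)`-tuple of `ℤ/p(p+2)` is a
sum of pairs `{a, -a}` or Aoki's standard element `σ_{p,a}` of a unit `a`. Unconditional (no named facts).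
THEOREM P1AF-1 of ROUTE-P1AF at `ℓ = p + 1`, twin case — now KERNEL. -/
theorem pqClassification_twin (p : ℕ) [Fact p.Prime] [Fact (p + 2).Prime] (hp : 11 ≤ p) :
    ∀ s : Multiset (ZMod (p * (p + 2))), IsHodgeMultiset s → Multiset.card s = p + 1 →
      (∃ Q : Multiset (ZMod (p * (p + 2))), (∀ a ∈ Q, a ≠ 0) ∧ s = Q + Q.map (fun a ↦ -a)) ∨
      ∃ a : ZMod (p * (p + 2)), IsUnit a ∧
        s = (Multiset.range p).map (fun i : ℕ ↦ a + (i : ZMod (p * (p + 2))) * ((p * (p + 2) / p : ℕ) : ZMod (p * (p + 2)))) +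
          {-((p : ZMod (p * (p + 2))) * a)} :=
  pqClassificationT p (p + 2) (by omega) (by omega) (by omega)

/-- **HC FOR THE FERMAT `(p−1)`-FOLDS OF TWIN DEGREE `p(p+2)`, `p ≥ 11`** (`X¹⁰₁₄₃`, `X¹⁶₃₂₃`, `X²⁸₈₉₉`, …),
granted the named facts of S0 and the statements S2↑, S2↓, S3a, S5 — exactly the hypotheses of the tree's
`PQ.hodgeConjectureFor_pq`. -/
theorem hodgeConjectureFor_twin
    (hJ : Aoki1987_claim_juxtaposition) (hC : Aoki1987_claim_of_claim_juxtaposition_paired)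
    (hP : Shioda_claim_paired) (hNS : AokiShioda1983_eigenline_le_neronSeveri) (hS : Aoki1987_claim_pStandard)
    (hPull : LevelClaimPull) (hPush : LevelClaimPush) (h3a : SemiClaim) (h5 : EigenStructure)
    {p : ℕ} [Fact p.Prime] [Fact (p + 2).Prime] (hp : 11 ≤ p)
    ⦃X : SchemeOver ℂ⦄ (hF : IsFermatVariety (p - 1) (p * (p + 2)) X) (hX : IsSmoothProjective (p - 1) X) :
    HodgeConjectureFor (p - 1) X :=
  hodgeConjectureFor_pqT hJ hC hP hNS hS hPull hPush h3a h5 (by omega) (by omega) (by omega) hF hX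

/-- The first twin level in numbers: `m = 143 = 11 · 13`, Hodge `12`-tuples (characters of `X¹⁰₁₄₃`).
 -/
theorem pqClassification_143 :
    haveI : Fact (Nat.Prime 11) := ⟨Nat.prime_eleven⟩
    haveI : Fact (Nat.Prime 13) := ⟨by norm_num⟩
    ∀ s : Multiset (ZMod (11 * 13)), IsHodgeMultiset s → Multiset.card s = 11 + 1 →
      (∃ Q : Multiset (ZMod (11 * 13)), (∀ a ∈ Q, a ≠ 0) ∧ s = Q + Q.map (fun a ↦ -a)) ∨
      ∃ a : ZMod (11 * 13), IsUnit a ∧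
        s = (Multiset.range 11).map (fun i : ℕ ↦ a + (i : ZMod (11 * 13)) * ((11 * 13 / 11 : ℕ) : ZMod (11 * 13))) +
          {-((11 : ZMod (11 * 13)) * a)} := by
  haveI : Fact (Nat.Prime 11) := ⟨Nat.prime_eleven⟩
  haveI : Fact (Nat.Prime 13) := ⟨by norm_num⟩
  exact pqClassificationT 11 13 (by norm_num) (by norm_num) (by norm_num)

/-- **ALL TWO-ODD-PRIME LEVELS AT ONCE**: for primes `5 ≤ p < q` (no further hypothesis), every Hodge
`(p+1)`-tuple of `ℤ/pq` is a sum of pairs or `σ_{p,a}` of a unit `a` — `pqClassificationT` for `q ≥ 11`, and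
the tree's `FiveQ.classification` at the one remaining level `(p, q) = (5, 7)`. -/
theorem pqClassification_all :
    ∀ (p q : ℕ) [Fact p.Prime] [Fact q.Prime], 5 ≤ p → p < q →
      ∀ s : Multiset (ZMod (p * q)), IsHodgeMultiset s → Multiset.card s = p + 1 →
        (∃ Q : Multiset (ZMod (p * q)), (∀ a ∈ Q, a ≠ 0) ∧ s = Q + Q.map (fun a ↦ -a)) ∨
        ∃ a : ZMod (p * q), IsUnit a ∧
          s = (Multiset.range p).map (fun i : ℕ ↦ a + (i : ZMod (p * q)) * ((p * q / p : ℕ) : ZMod (p * q))) +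
            {-((p : ZMod (p * q)) * a)} := by
  intro p q _ _ hp hpq s hs h6
  by_cases hq : 11 ≤ q
  · exact pqClassificationT p q hp hpq hq s hs h6
  · have hqP : q.Prime := Fact.out
    have hpP : p.Prime := Fact.out
    obtain rfl | rfl | rfl | rfl | rfl : q = 6 ∨ q = 7 ∨ q = 8 ∨ q = 9 ∨ q = 10 := by omega
    · exact absurd hqP (by norm_num)
    · obtain rfl | rfl : p = 5 ∨ p = 6 := by omega
      · rcases Summit.HodgeConjecture.HodgeConjecture.Theorems.CancelByAnyClaimLattice.FiveQ.classification
            (q := 7) (by norm_num) hs h6 with h | ⟨a, ha, hsa⟩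
        · exact Or.inl h
        · exact Or.inr ⟨a, ha, hsa⟩
      · exact absurd hpP (by norm_num)
    · exact absurd hqP (by norm_num)
    · exact absurd hqP (by norm_num)
    · exact absurd hqP (by norm_num)

/-- **HC PAY-OFF AT EVERY TWO-ODD-PRIME DEGREE**: for primes `5 ≤ p < q` (no further hypothesis) the Hodge
conjecture for the Fermat `(p-1)`-fold of degree `pq`, modulo the line's named facts and stub statements —
`hodgeConjectureFor_pqT` for `q ≥ 11` and the tree's `FiveQ.hodgeConjectureFor_fourfold_five_mul_prime` at
`(p, q) = (5, 7)`. -/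
theorem hodgeConjectureFor_pq_all
    (hJ : Aoki1987_claim_juxtaposition) (hC : Aoki1987_claim_of_claim_juxtaposition_paired)
    (hP : Shioda_claim_paired) (hNS : AokiShioda1983_eigenline_le_neronSeveri) (hS : Aoki1987_claim_pStandard)
    (hPull : LevelClaimPull) (hPush : LevelClaimPush) (h3a : SemiClaim) (h5 : EigenStructure)
    {p q : ℕ} [Fact p.Prime] [Fact q.Prime] (hp : 5 ≤ p) (hpq : p < q)
    ⦃X : SchemeOver ℂ⦄ (hF : IsFermatVariety (p - 1) (p * q) X) (hX : IsSmoothProjective (p - 1) X) :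
    HodgeConjectureFor (p - 1) X := by
  by_cases hq : 11 ≤ q
  · exact hodgeConjectureFor_pqT hJ hC hP hNS hS hPull hPush h3a h5 hp hpq hq hF hX
  · have hqP : q.Prime := Fact.out
    have hpP : p.Prime := Fact.out
    obtain rfl | rfl | rfl | rfl | rfl : q = 6 ∨ q = 7 ∨ q = 8 ∨ q = 9 ∨ q = 10 := by omega
    · exact absurd hqP (by norm_num)
    · obtain rfl | rfl : p = 5 ∨ p = 6 := by omega
      · exact Summit.HodgeConjecture.HodgeConjecture.Theorems.CancelByAnyClaimLattice.FiveQ.hodgeConjectureFor_fourfold_five_mul_prime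
          hJ hC hP hNS hS hPull hPush h3a h5 (q := 7) (by norm_num) hF hX
      · exact absurd hpP (by norm_num)
    · exact absurd hqP (by norm_num)
    · exact absurd hqP (by norm_num)
    · exact absurd hqP (by norm_num)

end Summit.HodgeConjecture.HodgeConjecture.Theorems.CancelByAnyClaimLattice.PQTwin

end
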